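import Summits.ResolutionOfSingularities.ResolutionOfSingularities.Theorems.FrobeniusLadderFInjectiveMacaulayficationTauFloorF5YChartAlgebra
import Summits.ResolutionOfSingularities.ResolutionOfSingularities.Theorems.FrobeniusLadderFInjectiveMacaulayficationFlatIntegralCM
import Literature.AlgebraicGeometry.Resolution.AffineBlowupAlgebra
import HarnessLib

/-!
# (N1-Y) The tower `T₃ = k[y,V₀,V₁,V₂][u][t][V₄]` IS the Rees chart `D(ȳ²)` of `Bl_τ(P2d4F5)`: `T₃ ≃+* A₀[τ/ȳ²] = blowupAlgebra τ ȳ²`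
# (crux `FInjectiveMacaulayfication` stmt-ResolutionOfSingularities-15315, chain w45a; res-L1-w45a-plan-1 R18.32 «(N1) ROW #2 TWO-SIDED → stub-3»;
# seat res-L1-w45a-stub-3 g10; pattern = res-L1-w45a-stub-1's `TauFloorOneCIChartIdent` p620521 / res-L1-w45a-stub-2's `TauFloorOneXChartIdent`)

[OURS · L1 W4.5a] Support file (`--supports stmt-ResolutionOfSingularities-15315 --as helper`); replaces the role of NO printed item; NOT a statement of
any manuscript; def-free; UNCONDITIONAL; characteristic-free. AI-written (AI review is weaker than expert review).

`A₀ = k[X0..X4]/(f)`, `f = X4² + X0²X4 + X1⁵ + X2⁵ + X3⁵`, `τ = Ideal.span {x̄0, x̄1², x̄2², x̄3², x̄4}`, tower `T₃` and maps `φ`, `ψ₁` of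
`TauFloorF5YChartAlgebra`.
* §1 `adjoinRoot_subring_eq_top` — a subring of `AdjoinRoot g` containing `R` and the root is everything (so ring maps out of the tower have their range
  where their generators go);
* §2 ★ `chartMap_injective` — `φ : T₃ → A₀[1/ȳ²]` is injective: the blow-down map extended to `A₀[1/ȳ²] → T₃[1/y²]` inverts it after `T₃ → T₃[1/y²]`, which
  is injective because `y²` is a NON-ZERO-DIVISOR of `T₃` — for free, `T₃` being FLAT over the domain `k[y,V₀,V₁,V₂]` (`FlatIntegralCM.mem_nonZeroDivisors_algebraMap_of_flat_of_ne_zero`);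
* §3 ★★ `exists_chartEquiv` — `∃ e : T₃ ≃+* blowupAlgebra τ ȳ²` with `y,V₀,V₁,V₂,u,t,V₄ ↦ ȳ, x̄/ȳ², ū²/ȳ², t̄²/ȳ², ū, t̄, z̄/ȳ²` (range `⊆` by §1 on the
  generators, `⊇` because the range is an `A₀`-subalgebra containing `g/ȳ²` for the five generators `g` of `τ`, `Algebra.adjoin_le`).
[cite: GortzWedhorn2020, (13.19) p. 415] [cite: StacksProject, Tag 0804]
-/

-- single-problem summit: the doubled namespace component is forced
set_option linter.dupNamespace false

noncomputable section

namespace Summit.ResolutionOfSingularities.ResolutionOfSingularities.Theorems.FInjectiveMacaulayfication.TauFloorF5YChartIdent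

open MvPolynomial IsLocalization Literature.AlgebraicGeometry.Resolution
open Summit.ResolutionOfSingularities.ResolutionOfSingularities.Theorems.FInjectiveMacaulayfication
open TauFloorF5YChartAlgebra

variable (k : Type) [Field k]

/-! ## §1 Subrings of `AdjoinRoot g` -/

/-- **A subring of `AdjoinRoot g` containing the coefficients and the root is everything.** [folklore] -/
theorem adjoinRoot_subring_eq_top {R : Type} [CommRing R] (g : Polynomial R) (S : Subring (AdjoinRoot g))
    (h0 : ∀ r : R, AdjoinRoot.of g r ∈ S) (h1 : AdjoinRoot.root g ∈ S) : ∀ x : AdjoinRoot g, x ∈ S := by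
  intro x
  induction x using AdjoinRoot.induction_on with
  | ih p =>
    induction p using Polynomial.induction_on with
    | C a => rw [AdjoinRoot.mk_C]; exact h0 a
    | add p q hp hq => rw [map_add]; exact S.add_mem hp hq
    | monomial n a _ =>
      rw [map_mul, map_pow, AdjoinRoot.mk_C, AdjoinRoot.mk_X]
      exact S.mul_mem (h0 a) (S.pow_mem h1 _)

/-! ## §2 The chart map is injective -/

set_option maxHeartbeats 800000 in
-- one `IsLocalization` lift + a generator-by-generator comparison of two ring maps out of the tower
/-- ★ **The chart map `φ : T₃ → A₀[1/ȳ²]` is injective**: with `ψ : A₀[1/ȳ²] → T₃[1/y²]` the extension of the blow-down map, `ψ ∘ φ = (T₃ → T₃[1/y²])`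
(checked on `k`, `y,V₀,V₁,V₂`, `u,t,V₄`), and `T₃ → T₃[1/y²]` is injective since `y²` is a non-zero-divisor of the FLAT `k[y,V₀,V₁,V₂]`-algebra `T₃`. [folklore] -/
theorem chartMap_injective (f : MvPolynomial (Fin 5) k) (hf : f = X 4 ^ 2 + X 0 ^ 2 * X 4 + X 1 ^ 5 + X 2 ^ 5 + X 3 ^ 5)
    (h₁ : Polynomial (MvPolynomial (Fin 4) k)) (hh₁ : h₁ = Polynomial.X ^ 2 - Polynomial.C (X 0 ^ 2 * X 2))
    (h₂ : Polynomial (AdjoinRoot h₁)) (hh₂ : h₂ = Polynomial.X ^ 2 - Polynomial.C (algebraMap (MvPolynomial (Fin 4) k) (AdjoinRoot h₁) (X 0 ^ 2 * X 3)))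
    (h₃ : Polynomial (AdjoinRoot h₂))
    (hh₃ : h₃ = Polynomial.X ^ 2 + (Polynomial.C (algebraMap (MvPolynomial (Fin 4) k) (AdjoinRoot h₂) (X 0 ^ 2 * X 1 ^ 2)) * Polynomial.X +
      Polynomial.C (algebraMap (MvPolynomial (Fin 4) k) (AdjoinRoot h₂) (X 0) +
        algebraMap (MvPolynomial (Fin 4) k) (AdjoinRoot h₂) (X 2 ^ 2) * AdjoinRoot.of h₂ (AdjoinRoot.root h₁) +
        algebraMap (MvPolynomial (Fin 4) k) (AdjoinRoot h₂) (X 3 ^ 2) * AdjoinRoot.root h₂)))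
    (φ : AdjoinRoot h₃ →+* Localization.Away (Ideal.Quotient.mk (Ideal.span {f}) (X 1) ^ 2 : MvPolynomial (Fin 5) k ⧸ Ideal.span {f}))
    (hφC : ∀ a : k, φ (algebraMap (MvPolynomial (Fin 4) k) (AdjoinRoot h₃) (C a)) =
      algebraMap (MvPolynomial (Fin 5) k ⧸ Ideal.span {f}) _ (Ideal.Quotient.mk (Ideal.span {f}) (C a)))
    (hφX : ∀ i : Fin 4, φ (algebraMap (MvPolynomial (Fin 4) k) (AdjoinRoot h₃) (X i)) =
      ![algebraMap (MvPolynomial (Fin 5) k ⧸ Ideal.span {f}) _ (Ideal.Quotient.mk (Ideal.span {f}) (X 1)),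
        algebraMap (MvPolynomial (Fin 5) k ⧸ Ideal.span {f}) _ (Ideal.Quotient.mk (Ideal.span {f}) (X 0)) * Away.invSelf (Ideal.Quotient.mk (Ideal.span {f}) (X 1) ^ 2),
        algebraMap (MvPolynomial (Fin 5) k ⧸ Ideal.span {f}) _ (Ideal.Quotient.mk (Ideal.span {f}) (X 2)) ^ 2 * Away.invSelf (Ideal.Quotient.mk (Ideal.span {f}) (X 1) ^ 2),
        algebraMap (MvPolynomial (Fin 5) k ⧸ Ideal.span {f}) _ (Ideal.Quotient.mk (Ideal.span {f}) (X 3)) ^ 2 * Away.invSelf (Ideal.Quotient.mk (Ideal.span {f}) (X 1) ^ 2)] i)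
    (hφu : φ (algebraMap (AdjoinRoot h₁) (AdjoinRoot h₃) (AdjoinRoot.root h₁)) =
      algebraMap (MvPolynomial (Fin 5) k ⧸ Ideal.span {f}) _ (Ideal.Quotient.mk (Ideal.span {f}) (X 2)))
    (hφt : φ (AdjoinRoot.of h₃ (AdjoinRoot.root h₂)) = algebraMap (MvPolynomial (Fin 5) k ⧸ Ideal.span {f}) _ (Ideal.Quotient.mk (Ideal.span {f}) (X 3)))
    (hφV : φ (AdjoinRoot.root h₃) =
      algebraMap (MvPolynomial (Fin 5) k ⧸ Ideal.span {f}) _ (Ideal.Quotient.mk (Ideal.span {f}) (X 4)) * Away.invSelf (Ideal.Quotient.mk (Ideal.span {f}) (X 1) ^ 2)) :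
    Function.Injective φ := by
  classical
  obtain ⟨hfree, -⟩ := free_finite_tower k h₁ hh₁ h₂ hh₂ h₃ hh₃
  let mkA : MvPolynomial (Fin 5) k →+* MvPolynomial (Fin 5) k ⧸ Ideal.span {f} := Ideal.Quotient.mk (Ideal.span {f})
  let L := Localization.Away (mkA (X 1) ^ 2)
  let ι : (MvPolynomial (Fin 5) k ⧸ Ideal.span {f}) →+* L := algebraMap _ _
  let inv : L := Away.invSelf (mkA (X 1) ^ 2)
  let aM : MvPolynomial (Fin 4) k →+* AdjoinRoot h₃ := algebraMap _ _
  let yT : AdjoinRoot h₃ := aM (X 0)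
  -- `y²` is a non-zero-divisor of `T₃` (flatness over the domain `B₀`), so `T₃ → T₃[1/y²]` is injective
  have hy2 : yT ^ 2 ∈ nonZeroDivisors (AdjoinRoot h₃) := by
    rw [← map_pow]
    exact FlatIntegralCM.mem_nonZeroDivisors_algebraMap_of_flat_of_ne_zero (pow_ne_zero 2 (X_ne_zero (0 : Fin 4)))
  let LT := Localization.Away (yT ^ 2)
  let ιT : AdjoinRoot h₃ →+* LT := algebraMap _ _
  have hιT_inj : Function.Injective ιT :=
    IsLocalization.injective LT (M := Submonoid.powers (yT ^ 2)) ((Submonoid.powers_le (P := nonZeroDivisors _)).mpr hy2)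
  -- the blow-down map and its extension `ψ : A₀[1/ȳ²] → T₃[1/y²]`
  obtain ⟨ψ₁, hψX, hψC⟩ := exists_blowdownMap k f hf h₁ hh₁ h₂ hh₂ h₃ hh₃
  have hψy : ψ₁ (mkA (X 1)) = yT := hψX 1
  have hψy2 : ψ₁ (mkA (X 1) ^ 2) = yT ^ 2 := by rw [map_pow, hψy]
  have hunit : IsUnit ((ιT.comp ψ₁) (mkA (X 1) ^ 2)) := by
    rw [RingHom.comp_apply, hψy2]
    exact IsLocalization.Away.algebraMap_isUnit (yT ^ 2)
  let ψ : L →+* LT := IsLocalization.Away.lift (mkA (X 1) ^ 2) hunit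
  have hψι : ∀ a, ψ (ι a) = ιT (ψ₁ a) := fun a => IsLocalization.Away.lift_eq (mkA (X 1) ^ 2) hunit a
  have hψi : ψ inv * ιT (yT ^ 2) = 1 := by
    have h1 : ψ inv * ψ (ι (mkA (X 1) ^ 2)) = 1 := by
      rw [← map_mul, mul_comm, Away.mul_invSelf, map_one]
    rwa [hψι, hψy2] at h1
  -- the relations of the tower, for the `V₁, V₂` generators
  have R1 : (algebraMap (AdjoinRoot h₁) (AdjoinRoot h₃) (AdjoinRoot.root h₁)) ^ 2 = yT ^ 2 * aM (X 2) := by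
    have h := congrArg (algebraMap (AdjoinRoot h₁) (AdjoinRoot h₃)) (root₁_sq k h₁ hh₁)
    rw [map_pow, ← AdjoinRoot.algebraMap_eq, ← IsScalarTower.algebraMap_apply, map_mul, map_pow] at h
    exact h
  have R2 : (AdjoinRoot.of h₃ (AdjoinRoot.root h₂)) ^ 2 = yT ^ 2 * aM (X 3) := by
    have h := congrArg (AdjoinRoot.of h₃) (root₂_sq k h₁ h₂ hh₂)
    rw [map_pow, ← AdjoinRoot.algebraMap_eq h₃, ← IsScalarTower.algebraMap_apply, map_mul, map_pow] at h
    exact h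
  -- `ψ ∘ φ = ιT`
  -- generic cancellation: `ιT (y² c) · ψ inv = ιT c`
  have hcan : ∀ c : AdjoinRoot h₃, ιT (yT ^ 2 * c) * ψ inv = ιT c := fun c => by
    rw [map_mul, mul_comm (ιT (yT ^ 2)), mul_assoc, mul_comm (ιT (yT ^ 2)), hψi, mul_one]
  have hcomp : ψ.comp φ = ιT := by
    refine tower_ringHom_ext k h₁ h₂ h₃ (fun a => ?_) (fun i => ?_) ?_ ?_ ?_
    · rw [RingHom.comp_apply, hφC, hψι, hψC]
    · rw [RingHom.comp_apply, hφX]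
      fin_cases i
      · change ψ (ι (mkA (X 1))) = ιT (aM (X 0))
        rw [hψι, hψy]
      · change ψ (ι (mkA (X 0)) * inv) = ιT (aM (X 1))
        rw [map_mul, hψι, hψX 0]
        exact hcan (aM (X 1))
      · change ψ (ι (mkA (X 2)) ^ 2 * inv) = ιT (aM (X 2))
        rw [map_mul, map_pow, hψι, hψX 2]
        change ιT (algebraMap (AdjoinRoot h₁) (AdjoinRoot h₃) (AdjoinRoot.root h₁)) ^ 2 * ψ inv = ιT (aM (X 2))
        rw [← map_pow ιT, R1]
        exact hcan (aM (X 2))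
      · change ψ (ι (mkA (X 3)) ^ 2 * inv) = ιT (aM (X 3))
        rw [map_mul, map_pow, hψι, hψX 3]
        change ιT (AdjoinRoot.of h₃ (AdjoinRoot.root h₂)) ^ 2 * ψ inv = ιT (aM (X 3))
        rw [← map_pow ιT, R2]
        exact hcan (aM (X 3))
    · rw [RingHom.comp_apply, hφu, hψι, hψX 2]; rfl
    · rw [RingHom.comp_apply, hφt, hψι, hψX 3]; rfl
    · rw [RingHom.comp_apply, hφV, map_mul, hψι, hψX 4]
      exact hcan (AdjoinRoot.root h₃)
  have h2 : Function.Injective (⇑ψ ∘ ⇑φ) := by rw [← RingHom.coe_comp, hcomp]; exact hιT_inj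
  exact h2.of_comp


/-! ## §3 ★★ `T₃ ≃ A₀[τ/ȳ²]` -/

set_option maxHeartbeats 1600000 in
-- generator bookkeeping on both sides (as in `TauFloorOneXChartIdent.exists_chartEquiv`)
/-- ★★ **The tower `T₃` is the Rees chart `D(ȳ²)` of `Bl_τ X`**: a ring isomorphism `e : T₃ ≃+* blowupAlgebra τ ȳ²` with
`y, V₀, V₁, V₂, u, t, V₄ ↦ ȳ, x̄/ȳ², ū²/ȳ², t̄²/ȳ², ū, t̄, z̄/ȳ²` (values in `A₀[1/ȳ²]`). [cite: GortzWedhorn2020, (13.19) p. 415] -/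
theorem exists_chartEquiv (f : MvPolynomial (Fin 5) k) (hf : f = X 4 ^ 2 + X 0 ^ 2 * X 4 + X 1 ^ 5 + X 2 ^ 5 + X 3 ^ 5)
    (h₁ : Polynomial (MvPolynomial (Fin 4) k)) (hh₁ : h₁ = Polynomial.X ^ 2 - Polynomial.C (X 0 ^ 2 * X 2))
    (h₂ : Polynomial (AdjoinRoot h₁)) (hh₂ : h₂ = Polynomial.X ^ 2 - Polynomial.C (algebraMap (MvPolynomial (Fin 4) k) (AdjoinRoot h₁) (X 0 ^ 2 * X 3)))
    (h₃ : Polynomial (AdjoinRoot h₂))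
    (hh₃ : h₃ = Polynomial.X ^ 2 + (Polynomial.C (algebraMap (MvPolynomial (Fin 4) k) (AdjoinRoot h₂) (X 0 ^ 2 * X 1 ^ 2)) * Polynomial.X +
      Polynomial.C (algebraMap (MvPolynomial (Fin 4) k) (AdjoinRoot h₂) (X 0) +
        algebraMap (MvPolynomial (Fin 4) k) (AdjoinRoot h₂) (X 2 ^ 2) * AdjoinRoot.of h₂ (AdjoinRoot.root h₁) +
        algebraMap (MvPolynomial (Fin 4) k) (AdjoinRoot h₂) (X 3 ^ 2) * AdjoinRoot.root h₂))) :
    ∃ e : AdjoinRoot h₃ ≃+*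
        blowupAlgebra (Ideal.span {Ideal.Quotient.mk (Ideal.span {f}) (X 0), Ideal.Quotient.mk (Ideal.span {f}) (X 1) ^ 2,
          Ideal.Quotient.mk (Ideal.span {f}) (X 2) ^ 2, Ideal.Quotient.mk (Ideal.span {f}) (X 3) ^ 2, Ideal.Quotient.mk (Ideal.span {f}) (X 4)} :
            Ideal (MvPolynomial (Fin 5) k ⧸ Ideal.span {f}))
          (Ideal.Quotient.mk (Ideal.span {f}) (X 1) ^ 2),
      (∀ a : k, ((e (algebraMap (MvPolynomial (Fin 4) k) (AdjoinRoot h₃) (C a)) : blowupAlgebra _ (Ideal.Quotient.mk (Ideal.span {f}) (X 1) ^ 2)) :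
          Localization.Away (Ideal.Quotient.mk (Ideal.span {f}) (X 1) ^ 2 : MvPolynomial (Fin 5) k ⧸ Ideal.span {f})) =
        algebraMap (MvPolynomial (Fin 5) k ⧸ Ideal.span {f}) _ (Ideal.Quotient.mk (Ideal.span {f}) (C a))) ∧
      (∀ i : Fin 4, ((e (algebraMap (MvPolynomial (Fin 4) k) (AdjoinRoot h₃) (X i)) : blowupAlgebra _ (Ideal.Quotient.mk (Ideal.span {f}) (X 1) ^ 2)) :
          Localization.Away (Ideal.Quotient.mk (Ideal.span {f}) (X 1) ^ 2 : MvPolynomial (Fin 5) k ⧸ Ideal.span {f})) =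
        ![algebraMap (MvPolynomial (Fin 5) k ⧸ Ideal.span {f}) _ (Ideal.Quotient.mk (Ideal.span {f}) (X 1)),
          algebraMap (MvPolynomial (Fin 5) k ⧸ Ideal.span {f}) _ (Ideal.Quotient.mk (Ideal.span {f}) (X 0)) * Away.invSelf (Ideal.Quotient.mk (Ideal.span {f}) (X 1) ^ 2),
          algebraMap (MvPolynomial (Fin 5) k ⧸ Ideal.span {f}) _ (Ideal.Quotient.mk (Ideal.span {f}) (X 2)) ^ 2 * Away.invSelf (Ideal.Quotient.mk (Ideal.span {f}) (X 1) ^ 2),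
          algebraMap (MvPolynomial (Fin 5) k ⧸ Ideal.span {f}) _ (Ideal.Quotient.mk (Ideal.span {f}) (X 3)) ^ 2 * Away.invSelf (Ideal.Quotient.mk (Ideal.span {f}) (X 1) ^ 2)] i) ∧
      ((e (algebraMap (AdjoinRoot h₁) (AdjoinRoot h₃) (AdjoinRoot.root h₁)) : blowupAlgebra _ (Ideal.Quotient.mk (Ideal.span {f}) (X 1) ^ 2)) :
          Localization.Away (Ideal.Quotient.mk (Ideal.span {f}) (X 1) ^ 2 : MvPolynomial (Fin 5) k ⧸ Ideal.span {f})) =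
        algebraMap (MvPolynomial (Fin 5) k ⧸ Ideal.span {f}) _ (Ideal.Quotient.mk (Ideal.span {f}) (X 2)) ∧
      ((e (AdjoinRoot.of h₃ (AdjoinRoot.root h₂)) : blowupAlgebra _ (Ideal.Quotient.mk (Ideal.span {f}) (X 1) ^ 2)) :
          Localization.Away (Ideal.Quotient.mk (Ideal.span {f}) (X 1) ^ 2 : MvPolynomial (Fin 5) k ⧸ Ideal.span {f})) =
        algebraMap (MvPolynomial (Fin 5) k ⧸ Ideal.span {f}) _ (Ideal.Quotient.mk (Ideal.span {f}) (X 3)) ∧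
      ((e (AdjoinRoot.root h₃) : blowupAlgebra _ (Ideal.Quotient.mk (Ideal.span {f}) (X 1) ^ 2)) :
          Localization.Away (Ideal.Quotient.mk (Ideal.span {f}) (X 1) ^ 2 : MvPolynomial (Fin 5) k ⧸ Ideal.span {f})) =
        algebraMap (MvPolynomial (Fin 5) k ⧸ Ideal.span {f}) _ (Ideal.Quotient.mk (Ideal.span {f}) (X 4)) * Away.invSelf (Ideal.Quotient.mk (Ideal.span {f}) (X 1) ^ 2) := by
  classical
  obtain ⟨φ, hφC, hφX, hφu, hφt, hφV⟩ := exists_chartMap k f hf h₁ hh₁ h₂ hh₂ h₃ hh₃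
  have hinj := chartMap_injective k f hf h₁ hh₁ h₂ hh₂ h₃ hh₃ φ hφC hφX hφu hφt hφV
  obtain ⟨ψ₁, hψX, hψC⟩ := exists_blowdownMap k f hf h₁ hh₁ h₂ hh₂ h₃ hh₃
  -- abbreviations (terms only)
  let mkA : MvPolynomial (Fin 5) k →+* MvPolynomial (Fin 5) k ⧸ Ideal.span {f} := Ideal.Quotient.mk (Ideal.span {f})
  let τ : Ideal (MvPolynomial (Fin 5) k ⧸ Ideal.span {f}) := Ideal.span {mkA (X 0), mkA (X 1) ^ 2, mkA (X 2) ^ 2, mkA (X 3) ^ 2, mkA (X 4)}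
  let L := Localization.Away (mkA (X 1) ^ 2)
  let B : Subalgebra (MvPolynomial (Fin 5) k ⧸ Ideal.span {f}) L := blowupAlgebra τ (mkA (X 1) ^ 2)
  let ι : (MvPolynomial (Fin 5) k ⧸ Ideal.span {f}) →+* L := algebraMap _ _
  let inv : L := Away.invSelf (mkA (X 1) ^ 2)
  let aM : MvPolynomial (Fin 4) k →+* AdjoinRoot h₃ := algebraMap _ _
  have hyi : ι (mkA (X 1)) ^ 2 * inv = 1 := by
    have h := Away.mul_invSelf (S := L) (mkA (X 1) ^ 2)
    rwa [map_pow] at h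
  -- (1) `φ ∘ ψ₁ = ι`
  have hφψ : φ.comp ψ₁ = ι := by
    refine Ideal.Quotient.ringHom_ext (MvPolynomial.ringHom_ext (fun a => ?_) (fun j => ?_))
    · change φ (ψ₁ (mkA (C a))) = ι (mkA (C a))
      rw [hψC, hφC]
    · change φ (ψ₁ (mkA (X j))) = ι (mkA (X j))
      rw [hψX]
      fin_cases j
      · change φ (aM (X 0) ^ 2 * aM (X 1)) = ι (mkA (X 0))
        rw [map_mul, map_pow, hφX 0, hφX 1]
        change ι (mkA (X 1)) ^ 2 * (ι (mkA (X 0)) * inv) = ι (mkA (X 0))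
        rw [mul_comm, mul_assoc, mul_comm inv, hyi, mul_one]
      · exact hφX 0
      · exact hφu
      · exact hφt
      · change φ (aM (X 0) ^ 2 * AdjoinRoot.root h₃) = ι (mkA (X 4))
        rw [map_mul, map_pow, hφX 0, hφV]
        change ι (mkA (X 1)) ^ 2 * (ι (mkA (X 4)) * inv) = ι (mkA (X 4))
        rw [mul_comm, mul_assoc, mul_comm inv, hyi, mul_one]
  have hι_mem : ∀ a, ι a ∈ φ.range := fun a => ⟨ψ₁ a, by rw [← RingHom.comp_apply, hφψ]⟩
  -- (2) `range φ ⊆ B`: every generator of the tower lands in `B`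
  have hB₀ : ∀ b : MvPolynomial (Fin 4) k, φ (aM b) ∈ B := by
    intro b
    induction b using MvPolynomial.induction_on with
    | C a => rw [hφC]; exact B.algebraMap_mem _
    | add p q hp hq => rw [map_add, map_add]; exact B.add_mem hp hq
    | mul_X p i hp =>
      rw [map_mul, map_mul]
      refine B.mul_mem hp ?_
      rw [hφX]
      fin_cases i
      · exact B.algebraMap_mem (mkA (X 1))
      · change ι (mkA (X 0)) * inv ∈ B
        exact div_mem_blowupAlgebra τ (mkA (X 1) ^ 2) (Ideal.subset_span (by simp))
      · change ι (mkA (X 2)) ^ 2 * inv ∈ B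
        rw [← map_pow ι]
        exact div_mem_blowupAlgebra τ (mkA (X 1) ^ 2) (Ideal.subset_span (by simp))
      · change ι (mkA (X 3)) ^ 2 * inv ∈ B
        rw [← map_pow ι]
        exact div_mem_blowupAlgebra τ (mkA (X 1) ^ 2) (Ideal.subset_span (by simp))
  have hrange_le : ∀ c, φ c ∈ B := by
    -- level 1, level 2, level 3 via `adjoinRoot_subring_eq_top`
    have l1 : ∀ x : AdjoinRoot h₁, ((φ.comp (AdjoinRoot.of h₃)).comp (AdjoinRoot.of h₂)) x ∈ B := by
      refine adjoinRoot_subring_eq_top h₁ (B.toSubring.comap ((φ.comp (AdjoinRoot.of h₃)).comp (AdjoinRoot.of h₂))) (fun b => ?_) ?_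
      · change φ (AdjoinRoot.of h₃ (AdjoinRoot.of h₂ (AdjoinRoot.of h₁ b))) ∈ B
        have : AdjoinRoot.of h₃ (AdjoinRoot.of h₂ (AdjoinRoot.of h₁ b)) = aM b := by
          rw [← AdjoinRoot.algebraMap_eq, ← AdjoinRoot.algebraMap_eq, ← AdjoinRoot.algebraMap_eq,
            ← IsScalarTower.algebraMap_apply, ← IsScalarTower.algebraMap_apply]
        rw [this]; exact hB₀ b
      · change φ (AdjoinRoot.of h₃ (AdjoinRoot.of h₂ (AdjoinRoot.root h₁))) ∈ B
        have : AdjoinRoot.of h₃ (AdjoinRoot.of h₂ (AdjoinRoot.root h₁)) = algebraMap (AdjoinRoot h₁) (AdjoinRoot h₃) (AdjoinRoot.root h₁) := by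
          rw [← AdjoinRoot.algebraMap_eq, ← AdjoinRoot.algebraMap_eq, ← IsScalarTower.algebraMap_apply]
        rw [this, hφu]; exact B.algebraMap_mem _
    have l2 : ∀ x : AdjoinRoot h₂, (φ.comp (AdjoinRoot.of h₃)) x ∈ B := by
      refine adjoinRoot_subring_eq_top h₂ (B.toSubring.comap (φ.comp (AdjoinRoot.of h₃))) (fun b => l1 b) ?_
      change φ (AdjoinRoot.of h₃ (AdjoinRoot.root h₂)) ∈ B
      rw [hφt]; exact B.algebraMap_mem _
    refine adjoinRoot_subring_eq_top h₃ (B.toSubring.comap φ) (fun b => l2 b) ?_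
    change φ (AdjoinRoot.root h₃) ∈ B
    rw [hφV]
    change ι (mkA (X 4)) * inv ∈ B
    exact div_mem_blowupAlgebra τ (mkA (X 1) ^ 2) (Ideal.subset_span (by simp))
  -- (3) `B ⊆ range φ`: the range is an `A₀`-subalgebra containing the generators `g/ȳ²`, `g ∈ τ`
  let Rφ : Subalgebra (MvPolynomial (Fin 5) k ⧸ Ideal.span {f}) L :=
    { carrier := φ.range
      mul_mem' := fun ha hb => φ.range.mul_mem ha hb
      one_mem' := φ.range.one_mem
      add_mem' := fun ha hb => φ.range.add_mem ha hb
      zero_mem' := φ.range.zero_mem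
      algebraMap_mem' := fun a => hι_mem a }
  have hgens : blowupAlgebraGens τ (mkA (X 1) ^ 2) ⊆ (Rφ : Set L) := by
    rintro _ ⟨g, hg, rfl⟩
    change ι g * inv ∈ φ.range
    refine Submodule.span_induction (p := fun g _ => ι g * inv ∈ φ.range) ?_ ?_ ?_ ?_ hg
    · intro g hg
      simp only [Set.mem_insert_iff, Set.mem_singleton_iff] at hg
      rcases hg with rfl | rfl | rfl | rfl | rfl
      · exact ⟨aM (X 1), hφX 1⟩
      · exact ⟨1, by rw [map_one, map_pow ι, hyi]⟩
      · exact ⟨aM (X 2), by rw [hφX 2, map_pow ι]; rfl⟩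
      · exact ⟨aM (X 3), by rw [hφX 3, map_pow ι]; rfl⟩
      · exact ⟨AdjoinRoot.root h₃, hφV⟩
    · rw [map_zero, zero_mul]; exact φ.range.zero_mem
    · intro a b _ _ ha hb
      rw [map_add, add_mul]; exact φ.range.add_mem ha hb
    · intro r a _ ha
      rw [smul_eq_mul, map_mul, mul_assoc]; exact φ.range.mul_mem (hι_mem r) ha
  have hle_range : B ≤ Rφ := Algebra.adjoin_le hgens
  -- (4) the equivalence
  have hsurj : Function.Surjective (φ.codRestrict B.toSubring fun c => hrange_le c) := by
    intro b
    obtain ⟨c, hc⟩ := (hle_range b.2 : (b : L) ∈ φ.range)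
    exact ⟨c, Subtype.ext hc⟩
  have hinj' : Function.Injective (φ.codRestrict B.toSubring fun c => hrange_le c) := fun a b h =>
    hinj (congrArg Subtype.val h)
  exact ⟨RingEquiv.ofBijective (φ.codRestrict B.toSubring fun c => hrange_le c) ⟨hinj', hsurj⟩, hφC, hφX, hφu, hφt, hφV⟩

end Summit.ResolutionOfSingularities.ResolutionOfSingularities.Theorems.FInjectiveMacaulayfication.TauFloorF5YChartIdent

end
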